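import Mathlib
import Summits.Ventures.PercRepro2.Defs
import Summits.Ventures.PercRepro2.Independence
import Summits.Ventures.PercRepro2.Harris
import Summits.Ventures.PercRepro2.Graph
import Summits.Ventures.PercRepro2.Exploration
import Summits.Ventures.PercRepro2.Events
import Summits.Ventures.PercRepro2.ObsIndependence
import Summits.Ventures.PercRepro2.BHKEvents
import Summits.Ventures.PercRepro2.CDRequired
import Summits.Ventures.PercRepro2.GateCylinder
import Summits.Ventures.PercRepro2.CutVertexDefs
import Summits.Ventures.PercRepro2.CDCylinder
import Summits.Ventures.PercRepro2.CDCutVertex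
import Summits.Ventures.PercRepro2.CDCycle

/-!
# Row 2′CD across a cut vertex whose far side is a cylinder UNDER `Q` — e.g. a cycle through
`y, a₂, a₃` (blind cell PercRepro2, mine-a g34; MINE-A.md §89.5)

`CDCutVertex.cd_of_cut_cylinder` (a cut vertex `y` separating `a₁` from `{a₂, o}`, `a₃` on the far side with
`{y ↔ a₃}` a cylinder) uses its cylinder hypothesis only in the fibrewise inequality `bside_anticorr`.
With `CDCycle.required_anticorr_of_cylinder_Q` in its place the hypothesis weakens to

  `{y ↮ a₂} ∩ {y ↔ a₃} = {y ↮ a₂} ∩ cylinder B`   ("`{y ↔ a₃}` is a cylinder in `G − a₂`"),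

which holds when the far side is a cycle through `y`, `a₂` and `a₃` (with `o` anywhere on it), or more
generally when the `y–a₃` routes avoiding `a₂` form one path of bridges of `G − a₂`.  The near side
(`a₁`'s) is arbitrary.  `bside_anticorr_Q`, `required_anticorr_of_cut_cylinder_Q`,
`cd_of_cut_cylinder_Q`; the tower argument is `CDCutVertex`'s, copied with one line changed.
No definition; one seat.
-/

namespace Summit.Ventures.PercRepro2

namespace CDCutCycle

section Main

variable {V : Type*} {E : Type*} [Fintype E] [DecidableEq E] [Fintype V] [DecidableEq V]
  {R : Type*} [Field R] [LinearOrder R] [IsStrictOrderedRing R]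

/-- **The fibrewise inequality on the far side, cylinder under `Q`.** -/
theorem bside_anticorr_Q (p : E → R) (hp : IsProbVec p) (ends : E → Sym2 V) (EB : Set E)
    [DecidablePred (· ∈ EB)] (y a₂ a₃ o : V) {𝓤 : Set (Set V)} (h𝓤 : IsUpperSet 𝓤) {B : Finset E}
    (hB : (connEvent ends y a₂)ᶜ ∩ connEvent ends y a₃ =
      (connEvent ends y a₂)ᶜ ∩ GateCylinder.cylinder B) :
    prob p (CutV.sideEvent EB ((connEvent ends y a₂)ᶜ ∩ clusterInEvent ends y 𝓤 ∩
        connEvent ends y a₃ ∩ connEvent ends a₂ o)) *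
      prob p (CutV.sideEvent EB ((connEvent ends y a₂)ᶜ ∩ connEvent ends y a₃)) ≤
    prob p (CutV.sideEvent EB ((connEvent ends y a₂)ᶜ ∩ clusterInEvent ends y 𝓤 ∩
        connEvent ends y a₃)) *
      prob p (CutV.sideEvent EB ((connEvent ends y a₂)ᶜ ∩ connEvent ends y a₃ ∩
        connEvent ends a₂ o)) := by
  rw [← CDCutVertex.prob_zeroOff_eq_prob_sideEvent, ← CDCutVertex.prob_zeroOff_eq_prob_sideEvent,
    ← CDCutVertex.prob_zeroOff_eq_prob_sideEvent, ← CDCutVertex.prob_zeroOff_eq_prob_sideEvent]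
  exact CDCycle.required_anticorr_of_cylinder_Q _ (CDCutVertex.isProbVec_zeroOff hp EB) ends y a₂ a₃ o
    h𝓤 hB

variable {ends : E → Sym2 V} {y : V} {VA VB : Set V} {EA EB : Set E} [DecidablePred (· ∈ EA)]
  [DecidablePred (· ∈ EB)]

/-- **The `a₃`-required anti-correlation across a cut vertex with a far side that is a cylinder
under `Q`.** -/
theorem required_anticorr_of_cut_cylinder_Q (p : E → R) (hp : IsProbVec p)
    (h : CutV.IsCut ends y VA VB EA EB) {a₁ a₂ a₃ o : V} (ha₁ : a₁ ∈ VA ∪ {y}) (ha₂ : a₂ ∈ VB)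
    (ho : o ∈ VB) (ha₃ : a₃ ∈ VB ∪ {y}) {𝓔 : Set (Set V)} (h𝓔 : IsUpperSet 𝓔) {B : Finset E}
    (hB : (connEvent ends y a₂)ᶜ ∩ connEvent ends y a₃ =
      (connEvent ends y a₂)ᶜ ∩ GateCylinder.cylinder B) :
    prob p ((connEvent ends a₁ a₂)ᶜ ∩ clusterInEvent ends a₁ 𝓔 ∩ connEvent ends a₁ a₃ ∩
          connEvent ends a₂ o) * prob p ((connEvent ends a₁ a₂)ᶜ ∩ connEvent ends a₁ a₃) ≤
      prob p ((connEvent ends a₁ a₂)ᶜ ∩ clusterInEvent ends a₁ 𝓔 ∩ connEvent ends a₁ a₃) *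
        prob p ((connEvent ends a₁ a₂)ᶜ ∩ connEvent ends a₁ a₃ ∩ connEvent ends a₂ o) := by
  obtain ⟨e1, e2, e3, e4⟩ := CDCutVertex.required_events_eq h ha₁ ha₂ ho ha₃ 𝓔
  have t1 := CDCutVertex.prob_eq_sum_tower p EA EB h.Edisj (connEvent ends a₁ y) (fun T =>
    (connEvent ends y a₂)ᶜ ∩ clusterInEvent ends y {W | cluster ends T a₁ ∪ W ∈ 𝓔} ∩
      connEvent ends y a₃ ∩ connEvent ends a₂ o)
  have t2 := CDCutVertex.prob_eq_sum_tower p EA EB h.Edisj (connEvent ends a₁ y) (fun _ =>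
    (connEvent ends y a₂)ᶜ ∩ connEvent ends y a₃)
  have t3 := CDCutVertex.prob_eq_sum_tower p EA EB h.Edisj (connEvent ends a₁ y) (fun T =>
    (connEvent ends y a₂)ᶜ ∩ clusterInEvent ends y {W | cluster ends T a₁ ∪ W ∈ 𝓔} ∩
      connEvent ends y a₃)
  have t4 := CDCutVertex.prob_eq_sum_tower p EA EB h.Edisj (connEvent ends a₁ y) (fun _ =>
    (connEvent ends y a₂)ᶜ ∩ connEvent ends y a₃ ∩ connEvent ends a₂ o)
  rw [e1, e3, e4, e2, t1, t3, t4, t2]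
  set w : Config E → R := fun ω => weight p ω * (connEvent ends a₁ y).indicator 1 (restrict EA ω)
    with hw
  have hw0 : ∀ ω, 0 ≤ w ω := fun ω =>
    mul_nonneg (weight_nonneg hp ω) (Set.indicator_apply_nonneg fun _ => zero_le_one)
  set Z := prob p (CutV.sideEvent EB ((connEvent ends y a₂)ᶜ ∩ connEvent ends y a₃)) with hZ
  set Zf := prob p (CutV.sideEvent EB ((connEvent ends y a₂)ᶜ ∩ connEvent ends y a₃ ∩
    connEvent ends a₂ o)) with hZf
  set X : Config E → R := fun ω => prob p (CutV.sideEvent EB ((connEvent ends y a₂)ᶜ ∩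
    clusterInEvent ends y {W | cluster ends (restrict EA ω) a₁ ∪ W ∈ 𝓔} ∩
    connEvent ends y a₃ ∩ connEvent ends a₂ o)) with hX
  set Y : Config E → R := fun ω => prob p (CutV.sideEvent EB ((connEvent ends y a₂)ᶜ ∩
    clusterInEvent ends y {W | cluster ends (restrict EA ω) a₁ ∪ W ∈ 𝓔} ∩
    connEvent ends y a₃)) with hY
  have hfib : ∀ ω, X ω * Z ≤ Y ω * Zf := fun ω =>
    bside_anticorr_Q p hp ends EB y a₂ a₃ o (CDCutVertex.isUpperSet_union_left h𝓔 _) hB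
  have hS0 : 0 ≤ ∑ ω, w ω := Finset.sum_nonneg fun ω _ => hw0 ω
  have sa : ∑ ω, weight p ω * ((connEvent ends a₁ y).indicator 1 (restrict EA ω) * X ω) =
      ∑ ω, w ω * X ω := Finset.sum_congr rfl fun ω _ => by rw [hw]; ring
  have sb : ∑ ω, weight p ω * ((connEvent ends a₁ y).indicator 1 (restrict EA ω) * Y ω) =
      ∑ ω, w ω * Y ω := Finset.sum_congr rfl fun ω _ => by rw [hw]; ring
  have sd : ∑ ω, weight p ω * ((connEvent ends a₁ y).indicator 1 (restrict EA ω) * Z) =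
      (∑ ω, w ω) * Z := by
    rw [Finset.sum_mul]; exact Finset.sum_congr rfl fun ω _ => by rw [hw]; ring
  have sc : ∑ ω, weight p ω * ((connEvent ends a₁ y).indicator 1 (restrict EA ω) * Zf) =
      (∑ ω, w ω) * Zf := by
    rw [Finset.sum_mul]; exact Finset.sum_congr rfl fun ω _ => by rw [hw]; ring
  show (∑ ω, weight p ω * ((connEvent ends a₁ y).indicator 1 (restrict EA ω) * X ω)) *
      (∑ ω, weight p ω * ((connEvent ends a₁ y).indicator 1 (restrict EA ω) * Z)) ≤
    (∑ ω, weight p ω * ((connEvent ends a₁ y).indicator 1 (restrict EA ω) * Y ω)) *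
      (∑ ω, weight p ω * ((connEvent ends a₁ y).indicator 1 (restrict EA ω) * Zf))
  rw [sa, sb, sc, sd]
  have hsum : ∑ ω, w ω * (X ω * Z) ≤ ∑ ω, w ω * (Y ω * Zf) :=
    Finset.sum_le_sum fun ω _ => mul_le_mul_of_nonneg_left (hfib ω) (hw0 ω)
  have hXZ : ∑ ω, w ω * (X ω * Z) = (∑ ω, w ω * X ω) * Z := by
    rw [Finset.sum_mul]; exact Finset.sum_congr rfl fun ω _ => by ring
  have hYZ : ∑ ω, w ω * (Y ω * Zf) = (∑ ω, w ω * Y ω) * Zf := by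
    rw [Finset.sum_mul]; exact Finset.sum_congr rfl fun ω _ => by ring
  rw [hXZ, hYZ] at hsum
  calc (∑ ω, w ω * X ω) * ((∑ ω, w ω) * Z) = ((∑ ω, w ω * X ω) * Z) * ∑ ω, w ω := by ring
    _ ≤ ((∑ ω, w ω * Y ω) * Zf) * ∑ ω, w ω := mul_le_mul_of_nonneg_right hsum hS0
    _ = (∑ ω, w ω * Y ω) * ((∑ ω, w ω) * Zf) := by ring

/-- **Row 2′CD across a cut vertex whose far side is a cylinder under `Q`.** `y` a cut vertex
separating `a₁ ∈ VA ∪ {y}` from `a₂, o ∈ VB`, `a₃ ∈ VB ∪ {y}` with `{y ↮ a₂} ∩ {y ↔ a₃} =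
{y ↮ a₂} ∩ cylinder B` (the far side a cycle through `y, a₂, a₃`, say): every up-set, every weight
vector. -/
theorem cd_of_cut_cylinder_Q (p : E → R) (hp : IsProbVec p) (h : CutV.IsCut ends y VA VB EA EB)
    {a₁ a₂ a₃ o : V} (ha₁ : a₁ ∈ VA ∪ {y}) (ha₂ : a₂ ∈ VB) (ho : o ∈ VB) (ha₃ : a₃ ∈ VB ∪ {y})
    {𝓔 : Set (Set V)} (h𝓔 : IsUpperSet 𝓔) {B : Finset E}
    (hB : (connEvent ends y a₂)ᶜ ∩ connEvent ends y a₃ =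
      (connEvent ends y a₂)ᶜ ∩ GateCylinder.cylinder B) :
    let Q := (connEvent ends a₁ a₂)ᶜ
    let U := clusterInEvent ends a₁ 𝓔
    let e := connEvent ends a₁ a₃
    let f := connEvent ends a₂ o
    let N := (connEvent ends a₁ a₃)ᶜ ∩ (connEvent ends a₂ a₃)ᶜ
    let oU := connEvent ends a₁ o ∪ connEvent ends a₂ o
    prob p (Q ∩ N) * (prob p Q * prob p (Q ∩ U ∩ e ∩ f) - prob p (Q ∩ U) * prob p (Q ∩ e ∩ f)) ≤
      prob p (Q ∩ N ∩ oU) * (prob p Q * prob p (Q ∩ U ∩ e) - prob p (Q ∩ U) * prob p (Q ∩ e)) :=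
  CDRequired.cd_of_required_anticorr p hp ends a₁ a₂ a₃ o h𝓔
    (required_anticorr_of_cut_cylinder_Q p hp h ha₁ ha₂ ho ha₃ h𝓔 hB)

end Main

end CDCutCycle

end Summit.Ventures.PercRepro2
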